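import Mathlib
import Summits.NavierStokesRegularity.NavierStokesRegularity.Theorems.ThreadingFluxSilentShellsJiuXinSlabIdentity
import HarnessLib

/-!
# Crux `PoloidalLiouville` (stmt-NavierStokesRegularity-1222, W1), crux idea «silent-shells»:
# towards the PRINTED Jiu–Xin Liouville theorem — bounds in the slab (axis Bernoulli with decay, mass of `k_ε`)

Fourth file for `SilentShells.jiuXin2008_thm53`: the ingredients of the `ε → 0⁺` step at fixed slab height `Z`.

* `axis_bernoulli_decay` — for a `C¹` steady Euler pair with `U` axisymmetric, `U → 0` and `P → p₀` at infinity: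
  `P(t e₂) − p₀ = −½ U₂(t e₂)² ≤ 0` on the axis (the head is constant along the axis and tends to `p₀`);
* core bounds on `B̄(0, 1+2Z)`: `|U_h|² ≤ M_U² ρ²` and `|P(x) − P(x − x_h)| ≤ M_P ‖x_h‖` for `ρ ≤ 1`, `|x₂| ≤ 2Z`
  (local sup of `‖DU‖`, `‖DP‖` + mean value from the axis), whence the slab pressure bound
  `P(x) − p₀ ≤ M_P δ/2 + (M_P/2δ + B) · min(ρ², 1)` for `|x₂| ≤ 2Z` and every `δ > 0`;
* `integral_vertCut_sq_kernel_le` — the UNIFORM MASS BOUND `∫ η_Z² k_ε ≤ (2S/3)·vol{ρ²≤4,|x₂|≤2Z}` for all `ε ≠ 0`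
  (divergence theorem for `χ_R η_Z² G_ε` + cylinder volume scaling, then `R → ∞`);
* `tendsto_integral_vertCut_sq_kernel_min` — `∫ η_Z² k_ε min(ρ²,1) → 0` as `ε → 0⁺`;
* `integrable_vertCut_sq_horSq_div` — `η_Z²|U_h|²/ρ² ∈ L¹` (the majorant for the `ε → 0⁺` limits of `…JiuXinSlabAbsorb`).

All `--supports stmt-NavierStokesRegularity-1222 --as helper`; W1 movement 0; NS regularity is NOT proved by any of this.
Reference: [JiuXin2008, Thm 5.3, (3.27)–(3.30)].
-/

-- the summit and its single problem share the name (D-0017 nested layout)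
set_option linter.dupNamespace false

noncomputable section

namespace Summit.NavierStokesRegularity.NavierStokesRegularity.Theorems.PoloidalLiouville.SilentShells

open Set Function Filter MeasureTheory Topology Metric
open scoped Topology RealInnerProductSpace ENNReal
open Literature.Analysis.FluidPDE
open Summit.NavierStokesRegularity.NavierStokesRegularity.Theorems.PoloidalLiouville.HorizonTower (E3)

namespace JiuXin

/-- A vector field tending to `0` at infinity is small outside a ball. -/
theorem exists_radius_of_tendsto_cocompact_zero {U : E3 → E3} (hU : Tendsto U (cocompact E3) (𝓝 0))
    {η : ℝ} (hη : 0 < η) : ∃ R₀ : ℝ, 0 < R₀ ∧ ∀ x : E3, R₀ ≤ ‖x‖ → ‖U x‖ ≤ η := by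
  have hev : ∀ᶠ x in cocompact E3, ‖U x‖ ≤ η := by
    have := (Metric.tendsto_nhds.mp hU) η hη
    exact this.mono fun x hx => by rw [dist_zero_right] at hx; exact hx.le
  obtain ⟨K, hK, hKf⟩ := mem_cocompact.mp hev
  obtain ⟨R₀, hR₀⟩ := hK.isBounded.subset_closedBall (0 : E3)
  refine ⟨max R₀ 0 + 1, by positivity, fun x hx => hKf ?_⟩
  intro hxK
  have := hR₀ hxK
  rw [Metric.mem_closedBall, dist_zero_right] at this
  linarith [le_max_left R₀ 0]

section Euler

variable {U : E3 → E3} {P : E3 → ℝ}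

/-- **Bernoulli on the axis, decaying version.** For a `C¹` steady Euler pair with axisymmetric `U`, `U → 0` and
`P → p₀` at infinity: `P(t e₂) − p₀ = −½U₂(t e₂)²` for every `t` — the head `½U₂² + P` is constant along the axis
(`U = U₂e₂` there) and tends to `p₀` along it. [cite: JiuXin2008, (3.27)–(3.28)] -/
theorem axis_bernoulli_decay (hU : ContDiff ℝ 1 U) (hP : ContDiff ℝ 1 P) (hax : IsAxisymmetric U)
    (hE : ∀ x, convect U U x + gradient P x = 0) (hU0 : Tendsto U (cocompact E3) (𝓝 0)) {p₀ : ℝ}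
    (hp : Tendsto P (cocompact E3) (𝓝 p₀)) (t : ℝ) :
    P (t • EuclideanSpace.single 2 (1 : ℝ)) - p₀ = -((U (t • EuclideanSpace.single 2 (1 : ℝ)) 2) ^ 2 / 2) := by
  set e : E3 := EuclideanSpace.single 2 (1 : ℝ) with he
  have hUd : Differentiable ℝ U := hU.differentiable one_ne_zero
  have hPd : Differentiable ℝ P := hP.differentiable one_ne_zero
  set f : ℝ → ℝ := fun s => (U (s • e) 2) ^ 2 / 2 + P (s • e) with hf
  have hline : ∀ s : ℝ, HasDerivAt (fun s : ℝ => s • e) e s := fun s => by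
    simpa using (hasDerivAt_id s).smul_const e
  have hderiv : ∀ s, HasDerivAt f 0 s := by
    intro s
    set a : E3 := s • e with ha
    have ha0 : a 0 = 0 := by simp [ha, he]
    have ha1 : a 1 = 0 := by simp [ha, he]
    have hU' : HasDerivAt (fun s : ℝ => U (s • e)) (fderiv ℝ U a e) s :=
      (hUd a).hasFDerivAt.comp_hasDerivAt s (hline s)
    have hU2 : HasDerivAt (fun s : ℝ => U (s • e) 2) (fderiv ℝ U a e 2) s :=
      (EuclideanSpace.proj (2 : Fin 3) : E3 →L[ℝ] ℝ).hasFDerivAt.comp_hasDerivAt s hU'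
    have hP' : HasDerivAt (fun s : ℝ => P (s • e)) (fderiv ℝ P a e) s :=
      (hPd a).hasFDerivAt.comp_hasDerivAt s (hline s)
    have hsum := ((hU2.pow 2).div_const 2).add hP'
    have hUa : U a = (U a 2) • e := apply_axis_eq_smul hax hUd ha0 ha1
    have hEa : fderiv ℝ P a e = -(U a 2 * fderiv ℝ U a e 2) := by
      have h1 := hE a
      rw [convect_apply, hUa, map_smul] at h1
      have h2 : gradient P a = -((U a 2) • fderiv ℝ U a e) := eq_neg_of_add_eq_zero_right h1
      have h3 : fderiv ℝ P a e = ⟪gradient P a, e⟫ := by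
        rw [gradient, InnerProductSpace.toDual_symm_apply]
      rw [h3, h2, inner_neg_left, inner_smul_left, he, EuclideanSpace.inner_single_right]
      simp
    have : (↑(2 : ℕ) * U (s • e) 2 ^ (2 - 1) * fderiv ℝ U a e 2) / 2 + fderiv ℝ P a e = 0 := by
      rw [hEa]; ring
    rw [this] at hsum
    exact hsum
  have hconst : ∀ s₁ s₂, f s₁ = f s₂ :=
    is_const_of_deriv_eq_zero (fun s => (hderiv s).differentiableAt) fun s => (hderiv s).deriv
  -- the head tends to `p₀` along the axis, hence equals `p₀`
  have he1 : ‖e‖ = 1 := by simp [he]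
  have hft : f t = p₀ := by
    apply eq_of_forall_dist_le
    intro η hη
    set η' : ℝ := min η 1 / 2 with hη'
    have hη'0 : 0 < η' := by positivity
    have hη'1 : η' ≤ 1 / 2 := by rw [hη']; linarith [min_le_right η 1]
    have hη'2 : η' ≤ η / 2 := by rw [hη']; linarith [min_le_left η 1]
    obtain ⟨R₁, hR₁, hU1⟩ := exists_radius_of_tendsto_cocompact_zero hU0 hη'0
    obtain ⟨R₂, hR₂, hP2⟩ := exists_radius_of_tendsto_cocompact hp hη'0
    set s : ℝ := max R₁ R₂ with hs
    have hs0 : 0 ≤ s := hR₁.le.trans (le_max_left _ _)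
    have hns : ‖s • e‖ = s := by rw [norm_smul, he1, mul_one, Real.norm_of_nonneg hs0]
    have h1 : ‖U (s • e)‖ ≤ η' := hU1 _ (by rw [hns]; exact le_max_left _ _)
    have h2 : |P (s • e) - p₀| ≤ η' := hP2 _ (by rw [hns]; exact le_max_right _ _)
    have h3 : |U (s • e) 2| ≤ η' := (((pow_le_pow_iff_left₀ (abs_nonneg _) (norm_nonneg _) two_ne_zero).mp (sq_abs_apply_two_le_norm_sq _))).trans h1
    have h4 : (U (s • e) 2) ^ 2 ≤ η' ^ 2 := by
      rw [← sq_abs]; exact pow_le_pow_left₀ (abs_nonneg _) h3 2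
    rw [hconst t s, Real.dist_eq, hf]
    simp only
    calc |U (s • e) 2 ^ 2 / 2 + P (s • e) - p₀| = |U (s • e) 2 ^ 2 / 2 + (P (s • e) - p₀)| := by ring_nf
      _ ≤ |U (s • e) 2 ^ 2 / 2| + |P (s • e) - p₀| := abs_add_le _ _
      _ ≤ η' ^ 2 / 2 + η' := by
          rw [abs_of_nonneg (by positivity)]
          gcongr
      _ ≤ η := by nlinarith
  have := hft
  rw [hf] at this
  simp only at this
  linarith

/-- **Core bound for the velocity.** On the compact core `{ρ² ≤ 1, |x₂| ≤ 2Z} ⊆ B̄(0, 1+2Z)`, an axisymmetric `C¹`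
field satisfies `|U_h(x)|² ≤ M_U² ρ²` with `M_U = sup_{B̄(0,1+2Z)} ‖DU‖` (mean value from the axis point `x − x_h`). -/
theorem horSq_le_core (hU : ContDiff ℝ 1 U) (hax : IsAxisymmetric U) {Z : ℝ} (hZ : 0 < Z) :
    ∃ M : ℝ, 0 ≤ M ∧ ∀ x : E3, cylSq x ≤ 1 → |x 2| ≤ 2 * Z →
      U x 0 * U x 0 + U x 1 * U x 1 ≤ M ^ 2 * cylSq x := by
  have hUd : Differentiable ℝ U := hU.differentiable one_ne_zero
  set K := Metric.closedBall (0 : E3) (1 + 2 * Z) with hK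
  obtain ⟨M, hM⟩ := (isCompact_closedBall (0 : E3) (1 + 2 * Z)).exists_bound_of_continuousOn
    ((hU.continuous_fderiv one_ne_zero).continuousOn (s := K))
  have hM0 : 0 ≤ M := (norm_nonneg _).trans (hM 0 (by simp; positivity))
  refine ⟨M, hM0, fun x hq hz => ?_⟩
  have hmemK : ∀ y : E3, cylSq y ≤ 1 → |y 2| ≤ 2 * Z → y ∈ K := by
    intro y hyq hyz
    rw [hK, Metric.mem_closedBall, dist_zero_right]
    have h1 : ‖y‖ ^ 2 ≤ (1 + 2 * Z) ^ 2 := by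
      rw [norm_sq_eq_cylSq_add, ← sq_abs (y 2)]
      nlinarith [abs_nonneg (y 2), pow_le_pow_left₀ (abs_nonneg _) hyz 2]
    exact (pow_le_pow_iff_left₀ (norm_nonneg y) (by positivity) two_ne_zero).mp h1
  set a : E3 := x - hor x with ha
  have ha0 : a 0 = 0 := (sub_hor_apply x).1
  have ha1 : a 1 = 0 := (sub_hor_apply x).2.1
  have ha2 : a 2 = x 2 := (sub_hor_apply x).2.2
  have haq : cylSq a = 0 := by simp [cylSq, ha0, ha1]
  have hxK : x ∈ K := hmemK x hq hz
  have haK : a ∈ K := hmemK a (by rw [haq]; norm_num) (by rw [ha2]; exact hz)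
  have hUa0 : U a 0 = 0 := hax.apply_zero_eq_zero_of_axis hUd ha0 ha1
  have hUa1 : U a 1 = 0 := hax.apply_one_eq_zero_of_axis hUd ha0 ha1
  have hmv : ‖U x - U a‖ ≤ M * ‖x - a‖ :=
    (convex_closedBall (0 : E3) (1 + 2 * Z)).norm_image_sub_le_of_norm_fderiv_le (fun y _ => hUd y)
      (fun y hy => hM y hy) haK hxK
  have hxa : ‖x - a‖ ^ 2 = cylSq x := by rw [ha, sub_sub_cancel, norm_hor_sq]
  have hsq : ‖U x - U a‖ ^ 2 ≤ M ^ 2 * cylSq x := by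
    rw [← hxa, ← mul_pow]; exact pow_le_pow_left₀ (norm_nonneg _) hmv 2
  have hcomp : U x 0 * U x 0 + U x 1 * U x 1 ≤ ‖U x - U a‖ ^ 2 := by
    have := horSq_le_norm_sq (U x - U a)
    simp only [PiLp.sub_apply, hUa0, hUa1, sub_zero] at this
    exact this
  exact hcomp.trans hsq

/-- **Core bound for the pressure** and the slab pressure bound: with `M_P = sup_{B̄(0,1+2Z)} ‖DP‖` and `|P − p₀| ≤ B`,
for `|x₂| ≤ 2Z` and every `δ > 0`: `P(x) − p₀ ≤ M_P δ/2 + (M_P/(2δ) + B) · min(ρ², 1)` (axis Bernoulli sign + mean value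
on the core, the trivial bound off the core). -/
theorem pressure_sub_le_slab (hU : ContDiff ℝ 1 U) (hP : ContDiff ℝ 1 P) (hax : IsAxisymmetric U)
    (hE : ∀ x, convect U U x + gradient P x = 0) (hU0 : Tendsto U (cocompact E3) (𝓝 0)) {p₀ : ℝ}
    (hp : Tendsto P (cocompact E3) (𝓝 p₀)) {Z : ℝ} (hZ : 0 < Z) :
    ∃ M B : ℝ, 0 ≤ M ∧ 0 ≤ B ∧ ∀ δ : ℝ, 0 < δ → ∀ x : E3, |x 2| ≤ 2 * Z →
      P x - p₀ ≤ M * (δ / 2) + (M / (2 * δ) + B) * min (cylSq x) 1 := by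
  have hPd : Differentiable ℝ P := hP.differentiable one_ne_zero
  set K := Metric.closedBall (0 : E3) (1 + 2 * Z) with hK
  obtain ⟨M, hM⟩ := (isCompact_closedBall (0 : E3) (1 + 2 * Z)).exists_bound_of_continuousOn
    ((hP.continuous_fderiv one_ne_zero).continuousOn (s := K))
  have hM0 : 0 ≤ M := (norm_nonneg _).trans (hM 0 (by simp; positivity))
  obtain ⟨B, hB0, hB⟩ := exists_bound_of_tendsto_cocompact hP.continuous hp
  refine ⟨M, B, hM0, hB0, fun δ hδ x hz => ?_⟩
  have hq0 := cylSq_nonneg x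
  by_cases hq : cylSq x ≤ 1
  · -- on the core: mean value from the axis point, where `P − p₀ ≤ 0`
    rw [min_eq_left hq]
    have hmemK : ∀ y : E3, cylSq y ≤ 1 → |y 2| ≤ 2 * Z → y ∈ K := by
      intro y hyq hyz
      rw [hK, Metric.mem_closedBall, dist_zero_right]
      have h1 : ‖y‖ ^ 2 ≤ (1 + 2 * Z) ^ 2 := by
        rw [norm_sq_eq_cylSq_add, ← sq_abs (y 2)]
        nlinarith [abs_nonneg (y 2), pow_le_pow_left₀ (abs_nonneg _) hyz 2]
      exact (pow_le_pow_iff_left₀ (norm_nonneg y) (by positivity) two_ne_zero).mp h1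
    set a : E3 := x - hor x with ha
    have ha0 : a 0 = 0 := (sub_hor_apply x).1
    have ha1 : a 1 = 0 := (sub_hor_apply x).2.1
    have ha2 : a 2 = x 2 := (sub_hor_apply x).2.2
    have haq : cylSq a = 0 := by simp [cylSq, ha0, ha1]
    have hxK : x ∈ K := hmemK x hq hz
    have haK : a ∈ K := hmemK a (by rw [haq]; norm_num) (by rw [ha2]; exact hz)
    have hmv : ‖P x - P a‖ ≤ M * ‖x - a‖ :=
      (convex_closedBall (0 : E3) (1 + 2 * Z)).norm_image_sub_le_of_norm_fderiv_le (fun y _ => hPd y)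
        (fun y hy => hM y hy) haK hxK
    rw [ha, sub_sub_cancel, Real.norm_eq_abs] at hmv
    have haxis : P (x - hor x) - p₀ ≤ 0 := by
      rw [sub_hor_eq_smul, axis_bernoulli_decay hU hP hax hE hU0 hp]
      have := sq_nonneg (U ((x 2) • EuclideanSpace.single 2 (1 : ℝ)) 2)
      linarith
    have hamgm := norm_le_half_add_sq_div (hor x) hδ
    rw [norm_hor_sq] at hamgm
    have h1 : P x - P (x - hor x) ≤ M * ‖hor x‖ := (le_abs_self _).trans hmv
    have h2 : M * ‖hor x‖ ≤ M * (δ / 2 + cylSq x / (2 * δ)) := mul_le_mul_of_nonneg_left hamgm hM0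
    have h3 : 0 ≤ B * cylSq x := mul_nonneg hB0 hq0
    calc P x - p₀ = (P x - P (x - hor x)) + (P (x - hor x) - p₀) := by ring
      _ ≤ M * (δ / 2 + cylSq x / (2 * δ)) + 0 := add_le_add (h1.trans h2) haxis
      _ ≤ M * (δ / 2) + (M / (2 * δ) + B) * cylSq x := by
          have : M * (δ / 2 + cylSq x / (2 * δ)) = M * (δ / 2) + M / (2 * δ) * cylSq x := by ring
          rw [this]; nlinarith
  · rw [not_le] at hq
    rw [min_eq_right hq.le]
    have h1 : P x - p₀ ≤ B := (le_abs_self _).trans (hB x)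
    nlinarith [mul_nonneg hM0 hδ.le, div_nonneg hM0 (by positivity : (0:ℝ) ≤ 2 * δ)]

end Euler

/-! ## The mass of `k_ε` in the slab -/

/-- **Uniform mass bound**: `∫ η_Z² · 2ε²/(ρ²+ε²)² ≤ (2S/3) · vol{ρ² ≤ 4, |x₂| ≤ 2Z}` for every `ε ≠ 0` (divergence theorem
for the compactly supported field `χ_R η_Z² G_ε`, whose divergence is `χ_R η_Z² k_ε + η_Z² c_R ρ²/(ρ²+ε²)`; the second term
lives in the cylinder `{ρ² ≤ 4R², |x₂| ≤ 2Z}` with size `≤ 2S/(3R²)`; then `R → ∞`). -/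
theorem integral_vertCut_sq_kernel_le {S : ℝ} (hS0 : 0 ≤ S) (hS : ∀ t, |deriv Real.smoothTransition t| ≤ S)
    {Z ε : ℝ} (hZ : 0 < Z) (hε : ε ≠ 0) :
    ∫ x, vertCut Z x ^ 2 * (2 * ε ^ 2 / (cylSq x + ε ^ 2) ^ 2) ≤
      2 * S / 3 * (volume (cyl 4 (2 * Z))).toReal := by
  set V : ℝ := (volume (cyl 4 (2 * Z))).toReal with hV
  set F : E3 → ℝ := fun x => vertCut Z x ^ 2 * (2 * ε ^ 2 / (cylSq x + ε ^ 2) ^ 2) with hF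
  have hηc : Continuous (vertCut Z) := (contDiff_vertCut (n := 0) Z).continuous
  have hkc : Continuous fun x : E3 => 2 * ε ^ 2 / (cylSq x + ε ^ 2) ^ 2 :=
    continuous_const.div ((continuous_cylSq.add continuous_const).pow 2)
      fun x => pow_ne_zero 2 (cylSq_add_sq_pos hε x).ne'
  have hFi : Integrable F (volume : Measure E3) := by
    refine integrable_of_le_vertCut_weight (K := 2 * ε ^ 2) hZ (by positivity : (0 : ℝ) < ε ^ 2)
      ((hηc.pow 2).mul hkc).aestronglyMeasurable fun x => ?_
    rw [hF, Real.norm_eq_abs, abs_of_nonneg (by positivity)]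
    exact le_of_eq (by ring)
  -- at finite `R`
  have hR : ∀ R : ℝ, 0 < R → ∫ x, cutoff R x * F x ≤ 2 * S / 3 * V := by
    intro R hR
    have hdiv0 := integral_divergence_eq_zero (contDiff_slabField (R := R) (Z := Z) hε)
      (hasCompactSupport_slabField hR Z ε)
    set M : E3 → ℝ := fun x => vertCut Z x ^ 2 * cutoffCoeff R x * (cylSq x / (cylSq x + ε ^ 2)) with hM
    have hpt : ∀ x, VectorCalculus.divergence (fun y => slabWeight R Z y • testField ε y) x =
        cutoff R x * F x + M x := by
      intro x; rw [divergence_slabField hε, slabWeight, hF, hM]; ring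
    simp_rw [hpt] at hdiv0
    have hcs : HasCompactSupport (cutoff R) := hasCompactSupport_cutoff hR
    have hccs : HasCompactSupport (cutoffCoeff R) := hasCompactSupport_cutoffCoeff hR
    have hi1 : Integrable (fun x => cutoff R x * F x) (volume : Measure E3) :=
      (((contDiff_cutoff (n := 0) R).continuous).mul ((hηc.pow 2).mul hkc)).integrable_of_hasCompactSupport
        hcs.mul_right
    have hi2 : Integrable M (volume : Measure E3) := by
      refine (((hηc.pow 2).mul (continuous_cutoffCoeff R)).mul
        (continuous_cylSq.div (continuous_cylSq.add continuous_const) fun x => (cylSq_add_sq_pos hε x).ne'))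
        |>.integrable_of_hasCompactSupport (hccs.mono fun x hx => ?_)
      rw [Function.mem_support] at hx ⊢
      contrapose! hx
      simp [hx]
    rw [integral_add hi1 hi2] at hdiv0
    -- the error term lives in the cylinder and is `≤ 2S/(3R²)` there
    have hzero : ∀ x, x ∉ cyl (4 * R ^ 2) (2 * Z) → M x = 0 := by
      intro x hx
      simp only [cyl, mem_setOf_eq, not_and_or, not_le] at hx
      rcases hx with hx | hx
      · have hn : 2 * R < ‖x‖ := by
          have h1 : (2 * R) ^ 2 < ‖x‖ ^ 2 := by rw [norm_sq_eq_cylSq_add]; nlinarith [sq_nonneg (x 2)]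
          exact (pow_lt_pow_iff_left₀ (by positivity) (norm_nonneg _) two_ne_zero).mp h1
        simp [hM, cutoffCoeff_eq_zero_of_lt_norm hR hn]
      · simp [hM, vertCut_eq_zero hZ hx.le]
    have hle : ∀ x ∈ cyl (4 * R ^ 2) (2 * Z), ‖M x‖ ≤ 2 * S / (3 * R ^ 2) := by
      intro x _
      rw [hM, Real.norm_eq_abs, abs_mul, abs_mul, abs_of_nonneg (sq_nonneg (vertCut Z x))]
      have h2 : vertCut Z x ^ 2 ≤ 1 := pow_le_one₀ (vertCut_nonneg Z x) (vertCut_le_one Z x)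
      have h3 := abs_cutoffCoeff_le hS R x
      have h4 : |cylSq x / (cylSq x + ε ^ 2)| ≤ 1 := by
        have hq := cylSq_add_sq_pos hε x
        rw [abs_of_nonneg (div_nonneg (cylSq_nonneg x) hq.le)]
        exact div_le_one_of_le₀ (by nlinarith [sq_nonneg ε]) hq.le
      calc vertCut Z x ^ 2 * |cutoffCoeff R x| * |cylSq x / (cylSq x + ε ^ 2)|
          ≤ 1 * (2 * S / (3 * R ^ 2)) * 1 := by gcongr
        _ = 2 * S / (3 * R ^ 2) := by ring
    have hMb := norm_integral_le_of_cyl hR (by positivity) hzero hle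
    have : ∫ x, cutoff R x * F x = -∫ x, M x := by linarith
    rw [this]
    calc -∫ x, M x ≤ ‖∫ x, M x‖ := by rw [Real.norm_eq_abs]; exact neg_le_abs _
      _ ≤ 2 * S / (3 * R ^ 2) * (R ^ 2 * V) := hMb
      _ = 2 * S / 3 * V := by field_simp
  -- `R → ∞`
  exact le_of_tendsto (tendsto_integral_cutoff_mul hFi)
    (by filter_upwards [eventually_gt_atTop (0 : ℝ)] with R hRpos using hR R hRpos)

section Core

variable {U : E3 → E3} {P : E3 → ℝ}

/-- `η_Z² |U_h|²/ρ²` is integrable (bounded by `M_U²` on the compact core, by `|U|²` off it). -/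
theorem integrable_vertCut_sq_horSq_div (hU : ContDiff ℝ 1 U) (hax : IsAxisymmetric U)
    (hL2 : MemLp U 2 (volume : Measure E3)) {Z : ℝ} (hZ : 0 < Z) :
    Integrable (fun x => vertCut Z x ^ 2 * ((U x 0 * U x 0 + U x 1 * U x 1) / cylSq x)) (volume : Measure E3) := by
  obtain ⟨M, hM0, hM⟩ := horSq_le_core hU hax hZ
  have hU2 := integrable_norm_sq_of_memLp hU.continuous hL2
  have hKc : IsCompact (Metric.closedBall (0 : E3) (1 + 2 * Z)) := isCompact_closedBall _ _
  have hind : Integrable ((Metric.closedBall (0 : E3) (1 + 2 * Z)).indicator fun _ => M ^ 2)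
      (volume : Measure E3) :=
    (integrable_indicator_iff hKc.measurableSet).mpr (integrableOn_const hKc.measure_lt_top.ne)
  refine Integrable.mono' (hind.add hU2) ?_ (Eventually.of_forall fun x => ?_)
  · exact (((contDiff_vertCut (n := 0) Z).continuous.pow 2).measurable.mul
      ((continuous_horSq hU.continuous).measurable.div continuous_cylSq.measurable)).aestronglyMeasurable
  · have hs0 := horSq_nonneg U x
    have hq0 := cylSq_nonneg x
    have hη2 : vertCut Z x ^ 2 ≤ 1 := pow_le_one₀ (vertCut_nonneg Z x) (vertCut_le_one Z x)
    rw [Real.norm_eq_abs, abs_of_nonneg (mul_nonneg (sq_nonneg _) (div_nonneg hs0 hq0)), Pi.add_apply]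
    by_cases hz : |x 2| ≤ 2 * Z
    · by_cases hq : cylSq x ≤ 1
      · have hxK : x ∈ Metric.closedBall (0 : E3) (1 + 2 * Z) := by
          rw [Metric.mem_closedBall, dist_zero_right]
          have h1 : ‖x‖ ^ 2 ≤ (1 + 2 * Z) ^ 2 := by
            rw [norm_sq_eq_cylSq_add, ← sq_abs (x 2)]
            nlinarith [abs_nonneg (x 2), pow_le_pow_left₀ (abs_nonneg _) hz 2]
          exact (pow_le_pow_iff_left₀ (norm_nonneg x) (by positivity) two_ne_zero).mp h1
        rw [indicator_of_mem hxK]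
        have hcore := hM x hq hz
        have h2 : (U x 0 * U x 0 + U x 1 * U x 1) / cylSq x ≤ M ^ 2 := by
          by_cases hq' : cylSq x = 0
          · rw [hq', div_zero]; positivity
          · rw [div_le_iff₀ (lt_of_le_of_ne hq0 (Ne.symm hq'))]; exact hcore
        calc vertCut Z x ^ 2 * ((U x 0 * U x 0 + U x 1 * U x 1) / cylSq x) ≤ 1 * M ^ 2 :=
            mul_le_mul hη2 h2 (div_nonneg hs0 hq0) zero_le_one
          _ ≤ M ^ 2 + ‖U x‖ ^ 2 := by nlinarith [norm_nonneg (U x)]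
      · rw [not_le] at hq
        have h2 : (U x 0 * U x 0 + U x 1 * U x 1) / cylSq x ≤ ‖U x‖ ^ 2 := by
          rw [div_le_iff₀ (by linarith)]
          nlinarith [horSq_le_norm_sq (U x), norm_nonneg (U x)]
        have h3 : 0 ≤ (Metric.closedBall (0 : E3) (1 + 2 * Z)).indicator (fun _ => M ^ 2) x :=
          Set.indicator_nonneg (fun _ _ => sq_nonneg M) x
        calc vertCut Z x ^ 2 * ((U x 0 * U x 0 + U x 1 * U x 1) / cylSq x) ≤ 1 * ‖U x‖ ^ 2 :=
            mul_le_mul hη2 h2 (div_nonneg hs0 hq0) zero_le_one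
          _ ≤ _ := by linarith
    · rw [not_le] at hz
      rw [vertCut_eq_zero hZ hz.le]
      have h3 : 0 ≤ (Metric.closedBall (0 : E3) (1 + 2 * Z)).indicator (fun _ => M ^ 2) x :=
        Set.indicator_nonneg (fun _ _ => sq_nonneg M) x
      simp only [ne_eq, OfNat.ofNat_ne_zero, not_false_eq_true, zero_pow, zero_mul]
      positivity

end Core

end JiuXin

end Summit.NavierStokesRegularity.NavierStokesRegularity.Theorems.PoloidalLiouville.SilentShells

end
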